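import Literature.Computability.Complexity.CircuitEval
import Literature.Computability.Complexity.CircuitComposition
import HarnessLib

/-!
# Programs of the circuit-evaluation machine are circuits (trunk CplxCore)

Companion of `CircuitEval.lean`, whose four-instruction value-stack machine (`CircEval.vmLoop`,
functional semantics `CircEval.vmSpec`, evaluator `CircEval.evalFn ∈ FP`) evaluates the
description `desc C` of a `B₂`-circuit. Here we prove the **converse direction** needed when
machine programs serve as *certificates for circuits* (the `NP`-verifier of the Minimum Circuit
Size Problem, `Literature/Computability/MetaComplexity/MCSPProofs.lean`): an arbitrary program
of the machine computes a Boolean function of small circuit complexity, namely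

* `CircEval.exists_circuit_of_isClean` / `CircEval.exists_circuit_evalFn` (**Theorem R**): for
  every *clean* program `D` (one that parses into whole instructions, `CircEval.isClean`) and every
  arity `n` there is a circuit `C` over `B₂` with `C.size ≤ max (tabCount D) 1` and
  `evalFn ⟨x, D⟩ = [C x]` for all `x : {0,1}ⁿ`, where `tabCount D` is the number of table
  instructions of `D`.

This is the straight-line-program view of circuits (Arora–Barak 2009, Rem. 6.4: a circuit of
size `s` is the same as a straight-line program with `s` binary operations) applied to the
machine: we run it *symbolically* (`CircEval.symRun`) on stacks of *wires* — an input `inl i`, an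
allocated gate `inr m`, or the constant sentinel `none = false` — allocating one `B₂`-gate per
`TAB` (`CircEval.mkGate`: the binary table on the two selected wires, constant arguments being
absorbed into a gate of smaller fan-in), and show that the concrete run on any input `x` is the
image of the symbolic run under the wire valuation (`CircEval.vmSpec_symRun`). The answer is then
the value of the top wire, i.e. of a single-output straight-line program with `tabCount D` gates
(`GateList.Realizes`, `CktSize.toCircuit` of `CircuitComposition.lean`), or the constant `false`
(one gate, `cktSize_const`) if the top entry is the sentinel — whence the `max · 1`.

For the completeness side of the verifier we also provide the clean program of a circuit,
`CircEval.progOf C = codeFrom 0 C.gates ++ rotCode (depth of the output)`: it has exactly `C.size`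
table instructions (`tabCount_progOf`; unlike `desc C` no copy gate is spent on the output),
computes `C` (`vmSpec_progOf`, from `vmSpec_codeFrom` and `vmSpec_rotCode` of `CircuitEval.lean`)
and has length `≤ (|C|+1)(8(n+|C|)+10)` (`length_progOf_le`); and the gate-free programs
`rotCode k`, which compute the projections `x ↦ x (n-1-k)` (`vmSpec_rotCode_proj`).

## References

* S. Arora, B. Barak, *Computational Complexity: A Modern Approach*, CUP 2009, Def. 6.1 and
  Rem. 6.4 (circuits as straight-line programs), Thm. 6.18 (proof: circuit evaluation in `P`).
* H. Vollmer, *Introduction to Circuit Complexity*, Springer 1999, §1.2 (composition of circuits).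
-/

namespace Literature.Computability.Complexity
namespace CircEval

open GateList

/-! ### Instruction counts and clean programs -/

/-- The number of `TAB` instructions in the opcode parse of a program of the value-stack machine
(`11 = ROT`, `10 = BACK`, `01 = READ`, `00 t₀ t₁ t₂ t₃ = TAB`; a truncated final `TAB` counts). [folklore] -/
def tabCount : List Bool → ℕ
  | [] => 0
  | [_] => 0
  | true :: _ :: D => tabCount D
  | false :: true :: D => tabCount D
  | false :: false :: D => tabCount (D.drop 4) + 1
termination_by D => D.length
decreasing_by all_goals simp <;> omega

/-- A program is *clean* if it parses into whole instructions: even length, and every `TAB`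
carries its four table bits. [folklore] -/
def isClean : List Bool → Bool
  | [] => true
  | [_] => false
  | true :: _ :: D => isClean D
  | false :: true :: D => isClean D
  | false :: false :: D => decide (4 ≤ D.length) && isClean (D.drop 4)
termination_by D => D.length
decreasing_by all_goals simp <;> omega

/-- The empty program has no table instruction. [folklore] -/
@[simp] theorem tabCount_nil : tabCount [] = 0 := by simp [tabCount]
/-- A dangling bit is not an instruction. [folklore] -/
@[simp] theorem tabCount_single (c : Bool) : tabCount [c] = 0 := by simp [tabCount]
/-- `ROT`/`BACK` are not table instructions. [folklore] -/
@[simp] theorem tabCount_tt (c : Bool) (D : List Bool) : tabCount (true :: c :: D) = tabCount D := by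
  simp [tabCount]
/-- `READ` is not a table instruction. [folklore] -/
@[simp] theorem tabCount_ft (D : List Bool) : tabCount (false :: true :: D) = tabCount D := by
  simp [tabCount]
/-- A `TAB` counts one and consumes its four table bits. [folklore] -/
@[simp] theorem tabCount_ff (D : List Bool) : tabCount (false :: false :: D) = tabCount (D.drop 4) + 1 := by
  simp [tabCount]
/-- The empty program is clean. [folklore] -/
@[simp] theorem isClean_nil : isClean [] = true := by simp [isClean]
/-- A dangling bit is not clean. [folklore] -/
@[simp] theorem isClean_single (c : Bool) : isClean [c] = false := by simp [isClean]
/-- `ROT`/`BACK` keep cleanliness. [folklore] -/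
@[simp] theorem isClean_tt (c : Bool) (D : List Bool) : isClean (true :: c :: D) = isClean D := by
  simp [isClean]
/-- `READ` keeps cleanliness. [folklore] -/
@[simp] theorem isClean_ft (D : List Bool) : isClean (false :: true :: D) = isClean D := by
  simp [isClean]
/-- A `TAB` is clean iff it carries four table bits and the rest is clean. [folklore] -/
@[simp] theorem isClean_ff (D : List Bool) :
    isClean (false :: false :: D) = (decide (4 ≤ D.length) && isClean (D.drop 4)) := by
  simp [isClean]

/-- Appending to a clean program: counts add. [folklore] -/
theorem tabCount_append : ∀ (N : ℕ) (A B : List Bool), A.length ≤ N → isClean A = true →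
    tabCount (A ++ B) = tabCount A + tabCount B
  | N, [], B, _, _ => by simp
  | N, [c], B, _, h => by simp at h
  | 0, _ :: _ :: _, B, hN, _ => by simp at hN
  | N + 1, true :: c :: A, B, hN, h => by
    simp only [List.cons_append, tabCount_tt, isClean_tt] at h ⊢
    exact tabCount_append N A B (by simp at hN; omega) h
  | N + 1, false :: true :: A, B, hN, h => by
    simp only [List.cons_append, tabCount_ft, isClean_ft] at h ⊢
    exact tabCount_append N A B (by simp at hN; omega) h
  | N + 1, false :: false :: A, B, hN, h => by
    simp only [List.cons_append, tabCount_ff, isClean_ff, Bool.and_eq_true, decide_eq_true_eq] at h ⊢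
    rw [List.drop_append_of_le_length h.1, tabCount_append N (A.drop 4) B (by simp at hN ⊢; omega) h.2]
    omega

/-- Appending to a clean program: cleanliness is that of the suffix. [folklore] -/
theorem isClean_append : ∀ (N : ℕ) (A B : List Bool), A.length ≤ N → isClean A = true →
    isClean (A ++ B) = isClean B
  | N, [], B, _, _ => by simp
  | N, [c], B, _, h => by simp at h
  | 0, _ :: _ :: _, B, hN, _ => by simp at hN
  | N + 1, true :: c :: A, B, hN, h => by
    simp only [List.cons_append, isClean_tt] at h ⊢
    exact isClean_append N A B (by simp at hN; omega) h
  | N + 1, false :: true :: A, B, hN, h => by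
    simp only [List.cons_append, isClean_ft] at h ⊢
    exact isClean_append N A B (by simp at hN; omega) h
  | N + 1, false :: false :: A, B, hN, h => by
    simp only [List.cons_append, isClean_ff, Bool.and_eq_true, decide_eq_true_eq] at h ⊢
    rw [List.drop_append_of_le_length h.1, isClean_append N (A.drop 4) B (by simp at hN ⊢; omega) h.2]
    simp only [List.length_append, Bool.and_eq_right_iff_imp, decide_eq_true_eq]
    intro; omega

/-- Rotation codes are clean. [folklore] -/
@[simp] theorem isClean_rotCode (e : ℕ) : isClean (rotCode e) = true := by
  induction e with
  | zero => simp [rotCode]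
  | succ e ih => simpa [rotCode] using ih

/-- Rotation codes contain no table instruction. [folklore] -/
@[simp] theorem tabCount_rotCode (e : ℕ) : tabCount (rotCode e) = 0 := by
  induction e with
  | zero => simp [rotCode]
  | succ e ih => simpa [rotCode] using ih

/-- Back-move codes are clean. [folklore] -/
@[simp] theorem isClean_backCode (e : ℕ) : isClean (backCode e) = true := by
  induction e with
  | zero => simp [backCode]
  | succ e ih => simpa [backCode] using ih

/-- Back-move codes contain no table instruction. [folklore] -/
@[simp] theorem tabCount_backCode (e : ℕ) : tabCount (backCode e) = 0 := by
  induction e with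
  | zero => simp [backCode]
  | succ e ih => simpa [backCode] using ih

/-- Read codes are clean. [folklore] -/
@[simp] theorem isClean_readCode (e : ℕ) : isClean (readCode e) = true := by
  rw [readCode, isClean_append _ _ _ le_rfl (isClean_rotCode e)]
  simp

/-- Read codes contain no table instruction. [folklore] -/
@[simp] theorem tabCount_readCode (e : ℕ) : tabCount (readCode e) = 0 := by
  rw [readCode, tabCount_append _ _ _ le_rfl (isClean_rotCode e)]
  simp

/-- A table instruction with its four entries is clean. [folklore] -/
@[simp] theorem isClean_tabCode (t0 t1 t2 t3 : Bool) : isClean (tabCode t0 t1 t2 t3) = true := by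
  simp [tabCode]

/-- A table instruction counts one. [folklore] -/
@[simp] theorem tabCount_tabCode (t0 t1 t2 t3 : Bool) : tabCount (tabCode t0 t1 t2 t3) = 1 := by
  simp [tabCode]


variable {n : ℕ}

/-! ### The symbolic machine -/

/-- Symbolic stack entries: a wire (input or gate) or the constant `false` (`none`). [folklore] -/
abbrev SVal (n : ℕ) : Type := Option (Fin n ⊕ ℕ)

/-- Symbolic configurations: the three stacks with symbolic entries and the gates allocated so far. [folklore] -/
structure SymSt (n : ℕ) where
  /-- value stack (symbolic entries) [folklore] -/
  V : List (SVal n)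
  /-- auxiliary stack (symbolic entries) [folklore] -/
  T : List (SVal n)
  /-- selection stack (symbolic entries) [folklore] -/
  S : List (SVal n)
  /-- gates allocated so far [folklore] -/
  gs : List (Gate (Fin n))

/-- Symbolic selection (`sel` with `none` for the missing bits). [folklore] -/
def ssel : List (SVal n) → SVal n × SVal n × List (SVal n)
  | b1 :: b0 :: S => (b0, b1, S)
  | [b1] => (none, b1, [])
  | [] => (none, none, [])

/-- The gate realising a binary table on two symbolic arguments: constant arguments are
absorbed, so the arity is the number of wire arguments (`≤ 2`). [cite: AroraBarakCC2009, Rem. 6.4] -/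
def mkGate (f : Bool → Bool → Bool) : SVal n → SVal n → Gate (Fin n)
  | none, none => ⟨0, fun _ => f false false, Fin.elim0⟩
  | some w, none => ⟨1, fun v => f (v 0) false, fun _ => w⟩
  | none, some w => ⟨1, fun v => f false (v 0), fun _ => w⟩
  | some w0, some w1 => ⟨2, fun v => f (v 0) (v 1), fun i => if i = 0 then w0 else w1⟩

/-- The symbolic `TAB`: allocate one gate with the table `tb` on the two selected arguments and
push its wire. [cite: AroraBarakCC2009, Rem. 6.4] -/
def symTab (tb : List Bool) (st : SymSt n) : SymSt n :=
  ⟨some (.inr st.gs.length) :: st.V, st.T, (ssel st.S).2.2,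
    st.gs ++ [mkGate (fun b0 b1 => tb.getD (idxOf b0 b1) false) (ssel st.S).1 (ssel st.S).2.1]⟩

/-- The symbolic `ROT`. [folklore] -/
def symRot (st : SymSt n) : SymSt n :=
  match st.V with
  | [] => st
  | a :: V => ⟨V, a :: st.T, st.S, st.gs⟩

/-- The symbolic `BACK`. [folklore] -/
def symBack (st : SymSt n) : SymSt n :=
  match st.T with
  | [] => st
  | a :: T => ⟨a :: st.V, T, st.S, st.gs⟩

/-- The symbolic `READ`. [folklore] -/
def symRead (st : SymSt n) : SymSt n :=
  match st.V with
  | [] => st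
  | a :: V => ⟨a :: V, st.T, a :: st.S, st.gs⟩

/-- The symbolic run of a program. [folklore] -/
def symRun : List Bool → SymSt n → SymSt n
  | [], st => st
  | [_], st => st
  | true :: true :: D, st => symRun D (symRot st)
  | true :: false :: D, st => symRun D (symBack st)
  | false :: true :: D, st => symRun D (symRead st)
  | false :: false :: D, st => symRun (D.drop 4) (symTab (D.take 4) st)
termination_by D => D.length
decreasing_by all_goals simp <;> omega

/-- Symbolic run of the empty program. [folklore] -/
@[simp] theorem symRun_nil (st : SymSt n) : symRun [] st = st := by simp [symRun]
/-- Symbolic run of a dangling bit. [folklore] -/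
@[simp] theorem symRun_single (c : Bool) (st : SymSt n) : symRun [c] st = st := by simp [symRun]
/-- Symbolic run of `ROT`. [folklore] -/
@[simp] theorem symRun_tt (D : List Bool) (st : SymSt n) : symRun (true :: true :: D) st = symRun D (symRot st) := by
  simp [symRun]
/-- Symbolic run of `BACK`. [folklore] -/
@[simp] theorem symRun_tf (D : List Bool) (st : SymSt n) : symRun (true :: false :: D) st = symRun D (symBack st) := by
  simp [symRun]
/-- Symbolic run of `READ`. [folklore] -/
@[simp] theorem symRun_ft (D : List Bool) (st : SymSt n) : symRun (false :: true :: D) st = symRun D (symRead st) := by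
  simp [symRun]
/-- Symbolic run of `TAB`. [folklore] -/
@[simp] theorem symRun_ff (D : List Bool) (st : SymSt n) :
    symRun (false :: false :: D) st = symRun (D.drop 4) (symTab (D.take 4) st) := by
  simp [symRun]

/-! ### Valuation of symbolic entries -/

/-- The value of a symbolic entry on input `x`, given the gates `gs`. [cite: AroraBarakCC2009, Rem. 6.4] -/
def wv (x : Fin n → Bool) (gs : List (Gate (Fin n))) : SVal n → Bool
  | none => false
  | some w => wireOf x (vals gs x) w

/-- The constant entry is `false`. [folklore] -/
@[simp] theorem wv_none (x : Fin n → Bool) (gs : List (Gate (Fin n))) : wv x gs none = false := rfl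
/-- A wire entry carries the value of the wire. [folklore] -/
@[simp] theorem wv_some (x : Fin n → Bool) (gs : List (Gate (Fin n))) (w : Fin n ⊕ ℕ) :
    wv x gs (some w) = wireOf x (vals gs x) w := rfl

/-- Wires of a list of symbolic entries point below `L`. [folklore] -/
def WOK (L : ℕ) (l : List (SVal n)) : Prop := ∀ m, some (Sum.inr m) ∈ l → m < L

/-- Validity of entries is monotone in the number of gates. [folklore] -/
theorem WOK.mono {L L' : ℕ} {l : List (SVal n)} (h : WOK L l) (hL : L ≤ L') : WOK L' l :=
  fun m hm => (h m hm).trans_le hL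

/-- The tail of a valid stack is valid. [folklore] -/
theorem WOK.of_cons {L : ℕ} {a : SVal n} {l : List (SVal n)} (h : WOK L (a :: l)) : WOK L l :=
  fun m hm => h m (List.mem_cons_of_mem _ hm)

/-- The top of a valid stack is valid. [folklore] -/
theorem WOK.head {L : ℕ} {a : SVal n} {l : List (SVal n)} (h : WOK L (a :: l)) : WOK L [a] :=
  fun m hm => h m (by simp at hm; simp [hm])

/-- Pushing a valid entry on a valid stack. [folklore] -/
theorem WOK.cons {L : ℕ} {a : SVal n} {l : List (SVal n)} (ha : WOK L [a]) (h : WOK L l) : WOK L (a :: l) := by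
  intro m hm
  rcases List.mem_cons.1 hm with hm | hm
  · exact ha m (by simp [hm])
  · exact h m hm

/-- The empty stack is valid. [folklore] -/
@[simp] theorem WOK.nil (L : ℕ) : WOK L ([] : List (SVal n)) := fun m hm => by simp at hm

/-- Valuations of valid entries are stable under allocating further gates. [folklore] -/
theorem wv_append {x : Fin n → Bool} {gs ex : List (Gate (Fin n))} {a : SVal n} (ha : WOK gs.length [a]) :
    wv x (gs ++ ex) a = wv x gs a := by
  cases a with
  | none => rfl
  | some w =>
    obtain ⟨ws, hws⟩ := vals_append_take gs ex x
    simp only [wv_some, hws]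
    exact wireOf_append_of_lt x _ _ w fun m hm => by rw [length_vals]; exact ha m (by simp [hm])

/-- Values of a valid stack are stable under allocating further gates. [folklore] -/
theorem map_wv_append {x : Fin n → Bool} {gs ex : List (Gate (Fin n))} {l : List (SVal n)} (hl : WOK gs.length l) :
    l.map (wv x (gs ++ ex)) = l.map (wv x gs) := by
  induction l with
  | nil => rfl
  | cons a l ih => rw [List.map_cons, List.map_cons, wv_append hl.head, ih hl.of_cons]

/-- Well-formed symbolic configurations. [folklore] -/
structure SymSt.OK (st : SymSt n) : Prop where
  wf : WF st.gs
  arity : ∀ g ∈ st.gs, g.arity ≤ 2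
  okV : WOK st.gs.length st.V
  okT : WOK st.gs.length st.T
  okS : WOK st.gs.length st.S

/-! ### One symbolic `TAB` -/

/-- The allocated gate has fan-in at most `2`, i.e. lies in `B₂`. [folklore] -/
theorem mkGate_arity (f : Bool → Bool → Bool) (a0 a1 : SVal n) : (mkGate f a0 a1).arity ≤ 2 := by
  cases a0 <;> cases a1 <;> simp [mkGate]

/-- The allocated gate only reads the wires of its symbolic arguments. [folklore] -/
theorem mkGate_ok {L : ℕ} (f : Bool → Bool → Bool) {a0 a1 : SVal n} (h0 : WOK L [a0]) (h1 : WOK L [a1]) :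
    GateOK L (mkGate f a0 a1) := by
  intro a m ha
  cases a0 with
  | none =>
    cases a1 with
    | none => exact a.elim0
    | some w1 => simp only [mkGate] at ha; exact h1 m (by simp [ha])
  | some w0 =>
    cases a1 with
    | none => simp only [mkGate] at ha; exact h0 m (by simp [ha])
    | some w1 =>
      simp only [mkGate] at ha
      split_ifs at ha
      · exact h0 m (by simp [ha])
      · exact h1 m (by simp [ha])

/-- The value of the allocated gate is the table applied to the values of its symbolic arguments. [folklore] -/
theorem mkGate_val (f : Bool → Bool → Bool) (a0 a1 : SVal n) (x : Fin n → Bool) (gs : List (Gate (Fin n))) :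
    ((mkGate f a0 a1).op fun a => wireOf x (vals gs x) ((mkGate f a0 a1).args a)) = f (wv x gs a0) (wv x gs a1) := by
  cases a0 <;> cases a1 <;> simp [mkGate]

/-- Symbolic selection of valid entries yields valid entries. [folklore] -/
theorem ssel_wok {L : ℕ} {S : List (SVal n)} (h : WOK L S) :
    WOK L [(ssel S).1] ∧ WOK L [(ssel S).2.1] ∧ WOK L (ssel S).2.2 := by
  rcases S with _ | ⟨b1, _ | ⟨b0, S⟩⟩
  · simp [ssel, WOK]
  · exact ⟨by simp [ssel, WOK], by simpa [ssel] using h.head, by simp [ssel]⟩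
  · exact ⟨h.of_cons.head, h.head, h.of_cons.of_cons⟩

/-- The symbolic `TAB` keeps configurations well formed. [folklore] -/
theorem symTab_ok (tb : List Bool) {st : SymSt n} (h : st.OK) : (symTab tb st).OK := by
  obtain ⟨h0, h1, h2⟩ := ssel_wok h.okS
  refine ⟨h.wf.append_singleton (mkGate_ok _ h0 h1), ?_, ?_, ?_, ?_⟩
  · intro g hg
    simp only [symTab, List.mem_append, List.mem_singleton] at hg
    rcases hg with hg | rfl
    · exact h.arity g hg
    · exact mkGate_arity _ _ _
  · simp only [symTab, List.length_append, List.length_singleton]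
    refine WOK.cons (fun m hm => ?_) (h.okV.mono (Nat.le_succ _))
    simp at hm; omega
  · simpa [symTab] using h.okT.mono (Nat.le_succ _)
  · simpa [symTab] using h2.mono (Nat.le_succ _)

/-- The symbolic `ROT` keeps configurations well formed. [folklore] -/
theorem symRot_ok {st : SymSt n} (h : st.OK) : (symRot st).OK := by
  unfold symRot; split
  · exact h
  · next a V hV =>
    have hV' : WOK st.gs.length (a :: V) := hV ▸ h.okV
    exact ⟨h.wf, h.arity, hV'.of_cons, hV'.head.cons h.okT, h.okS⟩

/-- The symbolic `BACK` keeps configurations well formed. [folklore] -/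
theorem symBack_ok {st : SymSt n} (h : st.OK) : (symBack st).OK := by
  unfold symBack; split
  · exact h
  · next a T hT =>
    have hT' : WOK st.gs.length (a :: T) := hT ▸ h.okT
    exact ⟨h.wf, h.arity, hT'.head.cons h.okV, hT'.of_cons, h.okS⟩

/-- The symbolic `READ` keeps configurations well formed. [folklore] -/
theorem symRead_ok {st : SymSt n} (h : st.OK) : (symRead st).OK := by
  unfold symRead; split
  · exact h
  · next a V hV =>
    have hV' : WOK st.gs.length (a :: V) := hV ▸ h.okV
    exact ⟨h.wf, h.arity, hV', h.okT, hV'.head.cons h.okS⟩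

/-- The symbolic run keeps configurations well formed, extends the gate list, and allocates
exactly `tabCount D` gates. [cite: AroraBarakCC2009, Rem. 6.4] -/
theorem symRun_ok : ∀ (N : ℕ) (D : List Bool) (st : SymSt n), D.length ≤ N → st.OK →
    (symRun D st).OK ∧ (∃ ex, (symRun D st).gs = st.gs ++ ex) ∧
      (symRun D st).gs.length = st.gs.length + tabCount D
  | N, [], st, _, h => ⟨by simpa using h, ⟨[], by simp⟩, by simp⟩
  | N, [c], st, _, h => ⟨by simpa using h, ⟨[], by simp⟩, by simp⟩
  | 0, _ :: _ :: _, st, hN, _ => by simp at hN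
  | N + 1, true :: true :: D, st, hN, h => by
    obtain ⟨h1, ⟨ex, h2⟩, h3⟩ := symRun_ok N D (symRot st) (by simp at hN; omega) (symRot_ok h)
    have hg : (symRot st).gs = st.gs := by unfold symRot; split <;> rfl
    exact ⟨by simpa using h1, ⟨ex, by simpa [hg] using h2⟩, by simpa [hg] using h3⟩
  | N + 1, true :: false :: D, st, hN, h => by
    obtain ⟨h1, ⟨ex, h2⟩, h3⟩ := symRun_ok N D (symBack st) (by simp at hN; omega) (symBack_ok h)
    have hg : (symBack st).gs = st.gs := by unfold symBack; split <;> rfl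
    exact ⟨by simpa using h1, ⟨ex, by simpa [hg] using h2⟩, by simpa [hg] using h3⟩
  | N + 1, false :: true :: D, st, hN, h => by
    obtain ⟨h1, ⟨ex, h2⟩, h3⟩ := symRun_ok N D (symRead st) (by simp at hN; omega) (symRead_ok h)
    have hg : (symRead st).gs = st.gs := by unfold symRead; split <;> rfl
    exact ⟨by simpa using h1, ⟨ex, by simpa [hg] using h2⟩, by simpa [hg] using h3⟩
  | N + 1, false :: false :: D, st, hN, h => by
    obtain ⟨h1, ⟨ex, h2⟩, h3⟩ := symRun_ok N (D.drop 4) (symTab (D.take 4) st) (by simp at hN ⊢; omega)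
      (symTab_ok _ h)
    refine ⟨by simpa using h1,
      ⟨mkGate (fun b0 b1 => (D.take 4).getD (idxOf b0 b1) false) (ssel st.S).1 (ssel st.S).2.1 :: ex,
        by simpa [symTab] using h2⟩, ?_⟩
    · have hl : (symTab (D.take 4) st).gs.length = st.gs.length + 1 := by simp [symTab]
      rw [symRun_ff, h3, hl, tabCount_ff]
      omega


/-! ### Simulation -/

/-- Concrete selection is the image of symbolic selection (the constant entry being `false`). [folklore] -/
theorem sel_map (w : SVal n → Bool) (hw : w none = false) (S : List (SVal n)) :
    sel (S.map w) = (w (ssel S).1, w (ssel S).2.1, (ssel S).2.2.map w) := by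
  rcases S with _ | ⟨b1, _ | ⟨b0, S⟩⟩ <;> simp [sel, ssel, hw]

/-- Table indices are `< 4`. [folklore] -/
theorem idxOf_lt (b0 b1 : Bool) : idxOf b0 b1 < 4 := by
  unfold idxOf; cases b0 <;> cases b1 <;> simp

/-- A `TAB` with a full table always pushes the selected entry. [folklore] -/
theorem tabV_eq_cons (D V S : List Bool) (hD : 4 ≤ D.length) :
    tabV D V S = (D.take 4).getD (idxOf (sel S).1 (sel S).2.1) false :: V := by
  have hidx : idxOf (sel S).1 (sel S).2.1 < (D.take 4).length := by
    simp only [List.length_take]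
    have := idxOf_lt (sel S).1 (sel S).2.1
    omega
  unfold tabV pickAt
  rw [Nat.sub_zero, List.getD_eq_getElem?_getD, List.getElem?_eq_getElem hidx]
  simp

/-- The wire pushed by a symbolic `TAB` carries, under any later gate list, the selected table
entry of the values of the two symbolic arguments. [cite: AroraBarakCC2009, Rem. 6.4] -/
theorem wv_symTab_new (x : Fin n → Bool) (tb : List Bool) {st : SymSt n} (h : st.OK)
    (ex : List (Gate (Fin n))) :
    wv x ((symTab tb st).gs ++ ex) (some (.inr st.gs.length)) =
      tb.getD (idxOf (wv x ((symTab tb st).gs ++ ex) (ssel st.S).1)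
        (wv x ((symTab tb st).gs ++ ex) (ssel st.S).2.1)) false := by
  obtain ⟨h0, h1, -⟩ := ssel_wok h.okS
  have hgs : (symTab tb st).gs = st.gs ++ [mkGate (fun b0 b1 => tb.getD (idxOf b0 b1) false)
      (ssel st.S).1 (ssel st.S).2.1] := rfl
  have e0 : wv x ((symTab tb st).gs ++ ex) (ssel st.S).1 = wv x st.gs (ssel st.S).1 := by
    rw [hgs, List.append_assoc]; exact wv_append h0
  have e1 : wv x ((symTab tb st).gs ++ ex) (ssel st.S).2.1 = wv x st.gs (ssel st.S).2.1 := by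
    rw [hgs, List.append_assoc]; exact wv_append h1
  rw [e0, e1, hgs]
  obtain ⟨ws, hws⟩ := vals_append_take (st.gs ++ [mkGate (fun b0 b1 => tb.getD (idxOf b0 b1) false)
      (ssel st.S).1 (ssel st.S).2.1]) ex x
  simp only [wv_some, wireOf_inr]
  rw [hws, vals_append_singleton, List.append_assoc, List.getD_eq_getElem?_getD,
    List.getElem?_append_right (by simp), length_vals, Nat.sub_self, List.singleton_append,
    List.getElem?_cons_zero, Option.getD_some, mkGate_val]

/-- **Simulation.** On a clean program, the concrete machine started on the values of a
well-formed symbolic configuration ends on the values of its symbolic run (values taken with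
respect to the final gate list). [cite: AroraBarakCC2009, Rem. 6.4] -/
theorem vmSpec_symRun (x : Fin n → Bool) : ∀ (N : ℕ) (D : List Bool) (st : SymSt n), D.length ≤ N →
    isClean D = true → st.OK →
    vmSpec D (st.V.map (wv x (symRun D st).gs)) (st.T.map (wv x (symRun D st).gs))
        (st.S.map (wv x (symRun D st).gs)) =
      ((symRun D st).V.map (wv x (symRun D st).gs), (symRun D st).T.map (wv x (symRun D st).gs),
        (symRun D st).S.map (wv x (symRun D st).gs))
  | N, [], st, _, _, _ => by simp [vmSpec]
  | N, [c], st, _, hc, _ => by simp at hc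
  | 0, _ :: _ :: _, st, hN, _, _ => by simp at hN
  | N + 1, true :: true :: D, st, hN, hc, h => by
    have hN' : D.length ≤ N := by simp at hN; omega
    rw [isClean_tt] at hc
    obtain ⟨V, T, S, gs⟩ := st
    rcases V with _ | ⟨a, V⟩
    · have e : symRot (⟨[], T, S, gs⟩ : SymSt n) = ⟨[], T, S, gs⟩ := rfl
      have ih := vmSpec_symRun x N D ⟨[], T, S, gs⟩ hN' hc (e ▸ symRot_ok h)
      simp only [symRun_tt, e, List.map_nil] at ih ⊢
      rw [← ih]; simp [vmSpec]
    · have e : symRot (⟨a :: V, T, S, gs⟩ : SymSt n) = ⟨V, a :: T, S, gs⟩ := rfl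
      have ih := vmSpec_symRun x N D ⟨V, a :: T, S, gs⟩ hN' hc (e ▸ symRot_ok h)
      simp only [symRun_tt, e, List.map_cons] at ih ⊢
      rw [← ih]; simp [vmSpec]
  | N + 1, true :: false :: D, st, hN, hc, h => by
    have hN' : D.length ≤ N := by simp at hN; omega
    rw [isClean_tt] at hc
    obtain ⟨V, T, S, gs⟩ := st
    rcases T with _ | ⟨a, T⟩
    · have e : symBack (⟨V, [], S, gs⟩ : SymSt n) = ⟨V, [], S, gs⟩ := rfl
      have ih := vmSpec_symRun x N D ⟨V, [], S, gs⟩ hN' hc (e ▸ symBack_ok h)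
      simp only [symRun_tf, e, List.map_nil] at ih ⊢
      rw [← ih]; simp [vmSpec]
    · have e : symBack (⟨V, a :: T, S, gs⟩ : SymSt n) = ⟨a :: V, T, S, gs⟩ := rfl
      have ih := vmSpec_symRun x N D ⟨a :: V, T, S, gs⟩ hN' hc (e ▸ symBack_ok h)
      simp only [symRun_tf, e, List.map_cons] at ih ⊢
      rw [← ih]; simp [vmSpec]
  | N + 1, false :: true :: D, st, hN, hc, h => by
    have hN' : D.length ≤ N := by simp at hN; omega
    rw [isClean_ft] at hc
    obtain ⟨V, T, S, gs⟩ := st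
    rcases V with _ | ⟨a, V⟩
    · have e : symRead (⟨[], T, S, gs⟩ : SymSt n) = ⟨[], T, S, gs⟩ := rfl
      have ih := vmSpec_symRun x N D ⟨[], T, S, gs⟩ hN' hc (e ▸ symRead_ok h)
      simp only [symRun_ft, e, List.map_nil] at ih ⊢
      rw [← ih]; simp [vmSpec]
    · have e : symRead (⟨a :: V, T, S, gs⟩ : SymSt n) = ⟨a :: V, T, a :: S, gs⟩ := rfl
      have ih := vmSpec_symRun x N D ⟨a :: V, T, a :: S, gs⟩ hN' hc (e ▸ symRead_ok h)
      simp only [symRun_ft, e, List.map_cons] at ih ⊢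
      rw [← ih]; simp [vmSpec]
  | N + 1, false :: false :: D, st, hN, hc, h => by
    simp only [isClean_ff, Bool.and_eq_true, decide_eq_true_eq] at hc
    have hN' : (D.drop 4).length ≤ N := by simp at hN ⊢; omega
    have h1 := symTab_ok (D.take 4) h
    have ih := vmSpec_symRun x N (D.drop 4) (symTab (D.take 4) st) hN' hc.2 h1
    obtain ⟨-, ⟨ex, hex⟩, -⟩ := symRun_ok N (D.drop 4) (symTab (D.take 4) st) hN' h1
    simp only [symRun_ff]
    rw [vmSpec_tab, tabV_eq_cons _ _ _ hc.1, sel_map _ rfl, ← ih]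
    simp only [symTab, List.map_cons]
    congr 2
    have key := wv_symTab_new x (D.take 4) h ex
    rw [← hex] at key
    exact key.symm


/-! ### From programs to circuits -/

/-- The symbolic initial configuration: the input wires (last input on top) above the constant
sentinel. [folklore] -/
def symInit (n : ℕ) : SymSt n :=
  ⟨(List.ofFn fun i : Fin n => (some (.inl i) : SVal n)).reverse ++ [none], [], [], []⟩

/-- The initial symbolic configuration is well formed (no gates, no gate wires). [folklore] -/
theorem symInit_ok (n : ℕ) : (symInit n).OK :=
  ⟨WF.nil, by simp [symInit], fun m hm => by simp [symInit] at hm, by simp [symInit], by simp [symInit]⟩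

/-- The values of the initial symbolic configuration are the laid-out input (`layV`). [folklore] -/
theorem map_wv_symInit (x : Fin n → Bool) (gs : List (Gate (Fin n))) :
    (symInit n).V.map (wv x gs) = layV [] (List.ofFn x) := by
  simp [symInit, layV, List.map_reverse, List.map_ofFn, Function.comp_def]

/-- The top symbolic entry (`none`, i.e. the constant `false`, for an empty stack). [folklore] -/
def ohead : List (SVal n) → SVal n
  | [] => none
  | a :: _ => a

/-- The top value of a stack of values is the value of the top symbolic entry. [folklore] -/
theorem headD_map_wv (x : Fin n → Bool) (gs : List (Gate (Fin n))) (l : List (SVal n)) :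
    (l.map (wv x gs)).headD false = wv x gs (ohead l) := by
  rcases l with _ | ⟨a, l⟩ <;> simp [ohead]

/-- The top entry of a nonempty stack is a member. [folklore] -/
theorem mem_of_ohead {l : List (SVal n)} {a : SVal n} (h : ohead l = a) (hl : l ≠ []) : a ∈ l := by
  rcases l with _ | ⟨b, l⟩
  · exact absurd rfl hl
  · simp only [ohead] at h; simp [h]

/-- The answer of the machine on a clean program is the value of the top symbolic entry of the
symbolic run. [cite: AroraBarakCC2009, Rem. 6.4] -/
theorem vmSpec_headD_eq_wv (x : Fin n → Bool) (D : List Bool) (hD : isClean D = true) :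
    (vmSpec D (layV [] (List.ofFn x)) [] []).1.headD false =
      wv x (symRun D (symInit n)).gs (ohead (symRun D (symInit n)).V) := by
  have h := vmSpec_symRun x D.length D (symInit n) le_rfl hD (symInit_ok n)
  rw [map_wv_symInit] at h
  simp only [symInit, List.map_nil] at h ⊢
  rw [h, headD_map_wv]

/-- **Every clean program computes a function of circuit complexity at most `max (#TAB) 1`
over `B₂`**: one gate per `TAB` (constant arguments absorbed), or the one-gate constant
circuit when the answer is the sentinel. [cite: AroraBarakCC2009, Rem. 6.4] -/
theorem exists_circuit_of_isClean (n : ℕ) (D : List Bool) (hD : isClean D = true) :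
    ∃ C : Circuit (Fin n), C.IsOver B2 ∧ C.size ≤ max (tabCount D) 1 ∧
      ∀ x : Fin n → Bool, (vmSpec D (layV [] (List.ofFn x)) [] []).1.headD false = C.eval x := by
  obtain ⟨hok, -, hlen⟩ := symRun_ok D.length D (symInit n) le_rfl (symInit_ok n)
  have hlen' : (symRun D (symInit n)).gs.length = tabCount D := by simpa [symInit] using hlen
  cases ho : ohead (symRun D (symInit n)).V with
  | none =>
    obtain ⟨C, hB, hs, hC⟩ := (cktSize_const (Fin n) false).toCircuit
    exact ⟨C, hB, hs.trans (le_max_right _ _), fun x => by rw [vmSpec_headD_eq_wv x D hD, ho, hC]; rfl⟩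
  | some w =>
    have hne : (symRun D (symInit n)).V ≠ [] := by intro he; simp [he, ohead] at ho
    have hw : ∀ m, w = .inr m → m < (symRun D (symInit n)).gs.length :=
      fun m hm => hok.okV m (hm ▸ mem_of_ohead ho hne)
    have hR : Realizes B2 (symRun D (symInit n)).gs (fun _ : Unit => w)
        (fun x _ => wv x (symRun D (symInit n)).gs (some w)) :=
      ⟨hok.wf, fun g hg => (hok.arity g hg : g.arity ≤ 2), fun _ m hm => hw m hm, fun x _ => rfl⟩
    have hS : CktSize B2 (fun x (_ : Unit) => wv x (symRun D (symInit n)).gs (some w))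
        (symRun D (symInit n)).gs.length := ⟨_, _, le_rfl, hR⟩
    obtain ⟨C, hB, hs, hC⟩ := hS.toCircuit
    refine ⟨C, hB, (hs.trans (hlen' ▸ le_max_left _ _)), fun x => ?_⟩
    rw [vmSpec_headD_eq_wv x D hD, ho, hC]

open BinSub in
/-- The evaluator on a pair `⟨w, D⟩`, in terms of the machine's functional semantics. [folklore] -/
theorem evalFn_boolPair (w D : List Bool) :
    evalFn (boolPair w D) = [(vmSpec D (layV [] w) [] []).1.headD false] := by
  rw [evalFn, parseSpec_boolPair, List.append_nil, List.reverse_reverse]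
  simp [layV]

/-- **Theorem R, evaluator form**: for every clean program `D` and arity `n` there is a
`B₂`-circuit of size `≤ max (#TAB D) 1` whose value on `x` is the evaluator's answer on
`⟨x, D⟩`. [cite: AroraBarakCC2009, Rem. 6.4] -/
theorem exists_circuit_evalFn (n : ℕ) (D : List Bool) (hD : isClean D = true) :
    ∃ C : Circuit (Fin n), C.IsOver B2 ∧ C.size ≤ max (tabCount D) 1 ∧
      ∀ x : Fin n → Bool, evalFn (boolPair (List.ofFn x) D) = [C.eval x] := by
  obtain ⟨C, hB, hs, hC⟩ := exists_circuit_of_isClean n D hD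
  exact ⟨C, hB, hs, fun x => by rw [evalFn_boolPair, hC]⟩

/-! ### Clean programs for circuits and projections -/

/-- The *program of a circuit*: the codes of its gates followed by the rotations bringing the
value of the output wire to the top (unlike `desc`, no copy gate is spent on the output, so the
program has exactly `C.size` table instructions). [cite: AroraBarakCC2009, Rem. 6.4] -/
def progOf (C : Circuit (Fin n)) : List Bool :=
  codeFrom 0 C.gates ++ rotCode (depth n C.size C.output)

/-- Gate codes are clean. [folklore] -/
@[simp] theorem isClean_gateCode (j : ℕ) (g : Gate (Fin n)) : isClean (gateCode j g) = true := by
  rw [gateCode, isClean_append _ _ _ le_rfl (by rw [isClean_append _ _ _ le_rfl (isClean_readCode _)]; simp)]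
  simp

/-- A gate code has exactly one table instruction. [folklore] -/
@[simp] theorem tabCount_gateCode (j : ℕ) (g : Gate (Fin n)) : tabCount (gateCode j g) = 1 := by
  have h1 : isClean (readCode (argDepth j g 0) ++ readCode (argDepth j g 1)) = true := by
    rw [isClean_append _ _ _ le_rfl (isClean_readCode _)]; simp
  rw [gateCode, tabCount_append _ _ _ le_rfl h1, tabCount_append _ _ _ le_rfl (isClean_readCode _)]
  simp

/-- Codes of gate lists are clean. [folklore] -/
@[simp] theorem isClean_codeFrom : ∀ (j : ℕ) (gs : List (Gate (Fin n))), isClean (codeFrom j gs) = true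
  | j, [] => by simp [codeFrom]
  | j, g :: gs => by rw [codeFrom, isClean_append _ _ _ le_rfl (isClean_gateCode j g), isClean_codeFrom]

/-- The code of a gate list has one table instruction per gate. [folklore] -/
@[simp] theorem tabCount_codeFrom : ∀ (j : ℕ) (gs : List (Gate (Fin n))), tabCount (codeFrom j gs) = gs.length
  | j, [] => by simp [codeFrom]
  | j, g :: gs => by
    rw [codeFrom, tabCount_append _ _ _ le_rfl (isClean_gateCode j g), tabCount_codeFrom, tabCount_gateCode]
    simp; omega

/-- The program of a circuit is clean. [folklore] -/
@[simp] theorem isClean_progOf (C : Circuit (Fin n)) : isClean (progOf C) = true := by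
  rw [progOf, isClean_append _ _ _ le_rfl (isClean_codeFrom _ _), isClean_rotCode]

/-- The program of a circuit has exactly `C.size` table instructions. [folklore] -/
@[simp] theorem tabCount_progOf (C : Circuit (Fin n)) : tabCount (progOf C) = C.size := by
  rw [progOf, tabCount_append _ _ _ le_rfl (isClean_codeFrom _ _), tabCount_codeFrom, tabCount_rotCode]
  rfl

/-- Head of a dropped list. [folklore] -/
theorem headD_drop (l : List Bool) (e : ℕ) : (l.drop e).headD false = l.getD e false := by
  rw [List.headD_eq_head?_getD, List.head?_drop, List.getD_eq_getElem?_getD]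

/-- **The program of a `B₂`-circuit computes the circuit.** [cite: AroraBarakCC2009, Rem. 6.4] -/
theorem vmSpec_progOf (C : Circuit (Fin n)) (hC : ∀ g ∈ C.gates, g.arity ≤ 2) (x : Fin n → Bool) :
    (vmSpec (progOf C) (layV [] (List.ofFn x)) [] []).1.headD false = C.eval x := by
  have h1 := vmSpec_codeFrom x C.gates [] hC (fun k hk a m h => by
    have := C.wf k hk a m h; simpa using this) (rotCode (depth n C.size C.output)) []
  rw [List.length_nil] at h1
  have hlen : (valsFrom x [] C.gates).length = C.size := by
    rw [length_valsFrom]; simp [Circuit.size]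
  have he : depth n C.size C.output ≤ (layV (valsFrom x [] C.gates) (List.ofFn x)).length := by
    have := depth_le (n := n) C.size C.output
    simp [hlen]; omega
  rw [progOf, h1, ← List.append_nil (rotCode _), vmSpec_rotCode _ _ _ _ _ he]
  simp only [vmSpec, headD_drop]
  rw [← hlen, getD_layV_depth x _ C.output (fun m hm => hlen ▸ C.wf_output m hm), eval_eq_wval]

/-- Length of the program of a circuit: `≤ (|C| + 1) (8 (n + |C|) + 10)`. [folklore] -/
theorem length_progOf_le (C : Circuit (Fin n)) : (progOf C).length ≤ (C.size + 1) * (8 * (n + C.size) + 10) := by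
  rw [progOf, List.length_append, length_rotCode]
  have h1 := length_codeFrom_le 0 C.gates
  have h2 := depth_le (n := n) C.size C.output
  simp only [zero_add, Circuit.size] at h1 h2 ⊢
  nlinarith

/-- **Rotations compute projections**: `ROT^k` on `n > k` inputs answers `x (n - 1 - k)`. [cite: AroraBarakCC2009, Rem. 6.4] -/
theorem vmSpec_rotCode_proj (k : ℕ) (hk : k < n) (x : Fin n → Bool) :
    (vmSpec (rotCode k) (layV [] (List.ofFn x)) [] []).1.headD false = x ⟨n - 1 - k, by omega⟩ := by
  have he : k ≤ (layV [] (List.ofFn x)).length := by simp; omega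
  rw [← List.append_nil (rotCode k), vmSpec_rotCode _ _ _ _ _ he]
  simp only [vmSpec, headD_drop, layV, List.reverse_nil, List.nil_append, List.getD_eq_getElem?_getD]
  rw [List.getElem?_append_left (by simp; omega), List.getElem?_reverse (by simp; omega)]
  simp [show n - 1 - k < n by omega]

end CircEval
end Literature.Computability.Complexity
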